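import Literature.NumberTheory.LFunctions.FeketePolyaKernelReweightedQuadratic
import HarnessLib

/-!
# No real zero for real primitive characters of conductor `38265 ≤ q ≤ 38615`: REWEIGHTED Fekete–Pólya rows, in the kernel

Topic `Literature/NumberTheory/LFunctions`; namespace `Literature.NumberTheory.LFunctions`. THEOREMS only (no
definition, no named fact, no `sorry`; standard axioms): one PUBLIC theorem **`noRealZero{Odd,Even}_fp_<q>`** per
fundamental discriminant `D`, `|D| = q ∈ [38265, 38615]`, with NO plain Fekete–Pólya witness in the scanned range but a REWEIGHTED one — the coefficients of `L(s, χ)·G(s)`, `G(s) = ∏(1 + ε_p p^(-s))` (`ε_p = ∓χ(p)`: remove / double the multiples of `p`; `ε_p = ±1` at `p ∣ q`), have non-negative iterated sums of some order over one period (`FeketePolyaReweighted.lean`, `FeketePolyaKernelCertificatesWeighted{,Wrappers}.lean`) — for every primitive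
quadratic `χ` mod `q` of the parity of `D` and every `σ ∈ (0, 1)`, `L(σ, χ) ≠ 0` (statement shape of the
`interval_cases` bullets of the `NoRealZero{Odd,Even}…` range files, so a range assembly cites them by name).
Cell `parity-realchar`, kernel floor of the wide column (TARGET §2 row 19), Fekete–Pólya lane (seat prover-2).

Method (engine v4, reweighted): `FeketePolyaKernelCertificatesWeighted{,Wrappers}.lean` — the iterated partial sums of
order `K` of the reweighted value stream are non-negative over one period `N`, decided in the kernel BLOCKWISE on packed
base-`2^b` digits (`blockCertD b e K N D₀ (rwTabs kind b ps N (twOf fs))`: weight tables = sums of dilated sign tables of the character from the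
quadratic-residue bitsets of the prime factors of the conductor — the factor list is part of each certificate,
primality by `norm_num` — prefix sums by one big-integer multiplication per order and block, sign test by one
AND), hence `G(σ)·ℜL(σ, χ) > 0` (the Laplace-integral form of MV (5.23) with the substitution `t ↦ dt`, `FeketePolyaReweighted`) and
`L(σ, χ) ≠ 0`.  Witnesses `(G, K)` from the reweighted scan of this seat (`HOME/parity-realchar-prover-2/tools-v4/fpscan4.c`, primes `≤ 17`,
periods `≤ 2·10⁶`; no kit); the digit width `b` is two bits above the size of
the running-sum bound recorded by the scan.  1 characters in this file (est. 34 kernel-s).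
Only the rows RESCUED by the reweighted scan (and not already covered by a plain witness) appear here; the rest stays with the
truncation certificates of the companion lane.

## References

* H. L. Montgomery, R. C. Vaughan, *Multiplicative Number Theory I*, CUP 2007, §9.3 Thm 9.13, §11.2.1
  Exercises 7–8. [MontgomeryVaughan2007]
* M. Fekete, G. Pólya, *Über ein Problem von Laguerre*, Rend. Circ. Mat. Palermo 34 (1912) 89–120. [FeketePolya1912]
-/

namespace Literature.NumberTheory.LFunctions

open FeketePolyaKernel

set_option maxHeartbeats 400000 in
/-- `D = 38265`: the even character `(·/38265)` of conductor `38265` (`38265`: 3 · 5 · 2551) — NO plain Fekete–Pólya witness in the scanned range; REWEIGHTED witness: the coefficients of `L(s, χ)·(1 + 5^{-s}) (1 + 7^{-s})` have non-negative iterated sums of order `5` over the period `1339275` (block certificate, digits of `85` bits, splitting depth `13`); est. `33.9` kernel-s. [cite: MontgomeryVaughan2007, §11.2.1 Exercises 7 (g), 8] -/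
theorem noRealZeroEven_fp_38265 :
    ∀ χ : DirichletCharacter ℂ 38265, χ.IsQuadratic → χ.IsPrimitive → χ.Even →
      ∀ σ : ℝ, 0 < σ → σ < 1 → χ.LFunction σ ≠ 0 :=
  good_even_of_odd_rw [3, 5, 2551] (by norm_num) (by decide) (by decide) [(5, 1), (7, 1)] 1339275 5 85 13 (by decide) (by decide) (by decide) (by decide) (by decide) (by decide)
    (Or.inr (by decide +kernel))

end Literature.NumberTheory.LFunctions
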